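import Summits.ValiantsHypothesis.ValiantsHypothesis.Theorems.BarrierLeverNaturalProofsAgainstAllLinearSizesCapstone
import Literature.Barriers.ValiantsHypothesis.AlgebraicNaturalProofs
import Literature.Computability.AlgebraicComplexity.DetInVP
import Literature.Computability.AlgebraicComplexity.ArithCircuitProofs
import Literature.Computability.AlgebraicComplexity.KRSTSelection

/-!
# Route BarrierLever — item `NaturalProofsAgainstAllLinearSizesOfCount` (stmt-ValiantsHypothesis-19261),
# part 1/3: the Baur–Strassen certificate as ONE polynomial in the coefficient variables

Continuation of `…NaturalProofsAgainstAllLinearSizesCapstone.lean` (the capstone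
`det_macaulay_grad_topForm_eq_zero` modulo the predicate `GenericGradientFibreCount k d`), cell memo
ROUTE-MEMO-p2-g4 §S2 ("coefficient-space packaging"):

* `macaulayR` — the square Macaulay matrix over a commutative RING of coefficients (the tree's
  `Literature.RingTheory.MvPolynomial.Macaulay.macaulay` is stated over a field; the two agree by
  `rfl` over a field, `macaulayR_eq_macaulay`), and its base change `map_macaulayR` — this is what
  makes the determinant ONE polynomial in the coefficients, evaluated;
* `restr` (restriction to the first `k` coordinates), `generic n` (the generic polynomial
  `Σ_{deg m ≤ n} X_m x^m` over the coefficient ring `ℂ[X_m]`), `map_eval_generic`;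
* `certPoly n k : MvPolynomial (degLEMonomials n) ℂ` — the determinant of the Macaulay matrix of the
  gradient of the top form of the generic polynomial restricted to `k` variables; `eval_certPoly`
  (its value at `coeffVector f` is the Macaulay determinant of `∇(f(x_≤k, 0))_n`), `certPoly_ne_zero`
  (value `1` at the padded Fermat polynomial `Σ_{j<k} x_j^n / n`), `eval_certPoly_eq_zero` (modulo
  the AG count it vanishes on every `f` of degree `≤ n`, size `≤ s` once `2^(k+3s) < (n-1)^k`);
* `naturalProofsAgainstLinearSize_of_inputs` — the level-`c` instance of item 20156 modulo the AG
  count, the arithmetic and the size bound `certPoly n (k n) ∈ Distinguishers ℂ n a` (parts 2/3: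
  `…OfCountSize.lean`, `…OfCount.lean`).

Lean text authored by the cell planner seat `valiant-natproofs-p2` (gen 4, HOME/NaturalBSAll-p2g4.lean,
referee REF-G11 PASS), ported by the prover seat (namespace; `macaulayR` replaces the scratch's
ring-general Macaulay matrix).

WHAT THIS IS NOT: the AG count `GenericGradientFibreCount` (item stmt-19256
`GradientGenericFibreCount`) is NOT proved here; nothing on FSV Question 6 / crux stmt-14610.

References: Baur–Strassen 1983 and Strassen's degree bound via the tree (`DegreeBoundFibres`);
[CoxLittleOSheaUsing2005] Ch. 3 §4 (Macaulay matrix); Berkowitz 1984 via `DetInVP`.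
-/

-- layout Summits/ValiantsHypothesis/ValiantsHypothesis forces the duplicated namespace component
set_option linter.dupNamespace false

noncomputable section

open MvPolynomial Finset

namespace Summit.ValiantsHypothesis.ValiantsHypothesis.Theorems.BarrierLever.NaturalProofsAgainstAllLinearSizes

open Literature.Computability.AlgebraicComplexity
open Literature.Computability.AlgebraicComplexity.DegreeBound Literature.RingTheory.MvPolynomial.Macaulay
open Literature.Barriers.ValiantsHypothesis

/-! ## The Macaulay matrix over a ring of coefficients -/

section macaulayR

variable {K : Type} [CommRing K]

/-- The row polynomial `(x^α / x_i^δ) · F_i`, `i = pick α`, over a commutative ring (same body as the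
tree's `Macaulay.rowPoly`, which is stated over a field). -/
def rowPolyR {k : ℕ} (δ : ℕ) (F : Fin k → MvPolynomial (Fin k) K)
    (α : mons k (critDeg k δ)) : MvPolynomial (Fin k) K :=
  monomial (α.1 - Finsupp.single (pick α) δ) 1 * F (pick α)

/-- **The square Macaulay matrix** at the critical degree, over a commutative ring of coefficients
(same body as the tree's `Macaulay.macaulay`). -/
def macaulayR {k : ℕ} (δ : ℕ) (F : Fin k → MvPolynomial (Fin k) K) :
    Matrix (mons k (critDeg k δ)) (mons k (critDeg k δ)) K :=
  fun α β => coeff β.1 (rowPolyR δ F α)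

/-- The Macaulay matrix commutes with base change (memo S2: this is what makes the determinant ONE
polynomial in the coefficients, evaluated). -/
theorem map_macaulayR {K' : Type} [CommRing K'] (φ : K →+* K') {k : ℕ} (δ : ℕ)
    (F : Fin k → MvPolynomial (Fin k) K) :
    φ.mapMatrix (macaulayR δ F) = macaulayR δ (fun i => map φ (F i)) := by
  ext α β
  simp only [RingHom.mapMatrix_apply, Matrix.map_apply, macaulayR, rowPolyR]
  rw [← coeff_map, map_mul, map_monomial, map_one]

/-- Over a field the ring version is the tree's `Macaulay.macaulay`, definitionally. -/
theorem macaulayR_eq_macaulay {L : Type} [Field L] {k : ℕ} (δ : ℕ)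
    (F : Fin k → MvPolynomial (Fin k) L) : macaulayR δ F = macaulay δ F := rfl

end macaulayR

/-! ## Memo S2 (coefficient-space packaging, parts (i)–(ii)): the certificate is ONE polynomial
`certPoly n k` in the `N = #degLEMonomials n` coefficient variables; its evaluation at
`coeffVector f` is the gradient-Macaulay determinant of the top form of `f(x_1..x_k, 0, .., 0)`, and
it is not the zero polynomial (value `1` at the padded Fermat polynomial `Σ_{j<k} x_j^n / n`). -/

section restriction

variable (R : Type) [CommSemiring R]

/-- Coordinate restriction to the first `k` variables: `x_j ↦ x_j` for `j < k`, `x_j ↦ 0` else. -/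
def restr (n k : ℕ) : Fin n → MvPolynomial (Fin k) R :=
  fun j => if h : (j : ℕ) < k then X ⟨j, h⟩ else 0

variable {R}

/-- Each `restr` value is a variable or zero. -/
theorem restr_spec (n k : ℕ) (j : Fin n) : (∃ i, restr R n k j = X i) ∨ restr R n k j = 0 := by
  unfold restr
  split_ifs with h
  · exact Or.inl ⟨_, rfl⟩
  · exact Or.inr rfl

/-- `restr` is compatible with base change. -/
theorem map_restr {S : Type} [CommSemiring S] (φ : R →+* S) (n k : ℕ) (j : Fin n) :
    map φ (restr R n k j) = restr S n k j := by
  unfold restr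
  split_ifs <;> simp

/-- On the first `k` coordinates `restr` is the identity. -/
theorem restr_castLE {n k : ℕ} (hk : k ≤ n) (i : Fin k) : restr R n k (Fin.castLE hk i) = X i := by
  unfold restr
  rw [dif_pos (by simp [i.is_lt])]
  congr 1

end restriction

/-- Restriction does not raise the degree. -/
theorem totalDegree_aeval_restr_le {n k : ℕ} (f : MvPolynomial (Fin n) ℂ) :
    (aeval (restr ℂ n k) f).totalDegree ≤ f.totalDegree := by
  classical
  rw [aeval_def, eval₂_eq']
  refine totalDegree_finsetSum_le fun d hd => (totalDegree_mul _ _).trans ?_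
  rw [show (algebraMap ℂ (MvPolynomial (Fin k) ℂ)) (coeff d f) = C (coeff d f) from rfl,
    totalDegree_C, zero_add]
  refine (totalDegree_finsetProd _ _).trans ?_
  calc ∑ i, (restr ℂ n k i ^ d i).totalDegree ≤ ∑ i, d i := Finset.sum_le_sum fun i _ => by
          refine (totalDegree_pow _ _).trans ?_
          have h1 : (restr ℂ n k i).totalDegree ≤ 1 := by
            unfold restr; split_ifs <;> simp [totalDegree_X]
          calc d i * (restr ℂ n k i).totalDegree ≤ d i * 1 := Nat.mul_le_mul_left _ h1
            _ = d i := mul_one _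
    _ = ∑ i ∈ d.support, d i := (Finset.sum_subset (Finset.subset_univ _) fun i _ hi => by
          simpa using hi).symm
    _ ≤ f.totalDegree := le_totalDegree hd

/-- `map` commutes with taking a homogeneous component. -/
theorem map_homogeneousComponent {σ R S : Type*} [CommSemiring R] [CommSemiring S] (φ : R →+* S)
    (m : ℕ) (p : MvPolynomial σ R) :
    map φ (homogeneousComponent m p) = homogeneousComponent m (map φ p) := by
  classical
  ext d
  simp only [coeff_map, coeff_homogeneousComponent]
  split_ifs <;> simp

/-- The generic polynomial `𝔣 = Σ_{deg m ≤ n} X_m · x^m` over the coefficient ring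
`ℂ[X_m : m ∈ degLEMonomials n]`. -/
def generic (n : ℕ) : MvPolynomial (Fin n) (MvPolynomial (degLEMonomials n) ℂ) :=
  ∑ m : degLEMonomials n, monomial m.1 (X m)

/-- Coefficients of the generic polynomial. -/
theorem coeff_generic {n : ℕ} (d : Fin n →₀ ℕ) :
    coeff d (generic n) = if h : d.degree ≤ n then X ⟨d, h⟩ else 0 := by
  classical
  simp only [generic, coeff_sum, coeff_monomial]
  split_ifs with h
  · rw [Finset.sum_eq_single ⟨d, h⟩]
    · simp
    · intro m _ hm
      rw [if_neg]
      intro e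
      exact hm (Subtype.ext e)
    · simp
  · refine Finset.sum_eq_zero fun m _ => ?_
    rw [if_neg]
    intro e
    exact h (e ▸ m.2)

/-- Specialising the generic polynomial at `coeffVector f` recovers `f` (when `deg f ≤ n`). -/
theorem map_eval_generic {n : ℕ} (f : MvPolynomial (Fin n) ℂ) (hf : f.totalDegree ≤ n) :
    map (eval (coeffVector (degLEMonomials n) f)) (generic n) = f := by
  classical
  ext d
  rw [coeff_map, coeff_generic]
  split_ifs with h
  · simp [coeffVector]
  · rw [map_zero, eq_comm]
    apply coeff_eq_zero_of_totalDegree_lt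
    rw [← Finsupp.degree_apply]
    omega

/-- **The certificate as ONE polynomial in the coefficient variables** (memo S2). -/
def certPoly (n k : ℕ) : MvPolynomial (degLEMonomials n) ℂ :=
  (macaulayR (n - 1) (fun i => pderiv i (homogeneousComponent n
    (aeval (restr (MvPolynomial (degLEMonomials n) ℂ) n k) (generic n))))).det

/-- **Memo S2(i)**: evaluation compatibility. -/
theorem eval_certPoly {n : ℕ} (k : ℕ) (f : MvPolynomial (Fin n) ℂ) (hf : f.totalDegree ≤ n) :
    eval (coeffVector (degLEMonomials n) f) (certPoly n k) =
      (macaulay (n - 1) (fun i => pderiv i (homogeneousComponent n (aeval (restr ℂ n k) f)))).det := by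
  rw [certPoly, RingHom.map_det, map_macaulayR, ← macaulayR_eq_macaulay]
  have hF : (fun i => map (eval (coeffVector (degLEMonomials n) f)) (pderiv i (homogeneousComponent n
      (aeval (restr (MvPolynomial (degLEMonomials n) ℂ) n k) (generic n))))) =
      fun i => pderiv i (homogeneousComponent n (aeval (restr ℂ n k) f)) := by
    funext i
    rw [← pderiv_map, map_homogeneousComponent]
    congr 2
    rw [show aeval (restr (MvPolynomial (degLEMonomials n) ℂ) n k) (generic n) =
        bind₁ (restr (MvPolynomial (degLEMonomials n) ℂ) n k) (generic n) from by rw [aeval_eq_bind₁],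
      map_bind₁]
    simp_rw [map_restr]
    rw [map_eval_generic f hf, aeval_eq_bind₁]
  rw [hF]

/-- **Memo S2(ii)**: the certificate is not the zero polynomial — at the padded Fermat polynomial
`Σ_{j<k} x_j^n / n` the restricted top form is `Σ_{i<k} x_i^n / n`, its gradient is `(x_i^{n-1})_i`,
and the Macaulay matrix is the identity. -/
theorem certPoly_ne_zero {n k : ℕ} (hn : 1 ≤ n) (hk : k ≤ n) : certPoly n k ≠ 0 := by
  classical
  set f₀ : MvPolynomial (Fin n) ℂ := ∑ i : Fin k, C ((n : ℂ)⁻¹) * X (Fin.castLE hk i) ^ n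
    with hf₀def
  have hdeg : f₀.totalDegree ≤ n := by
    refine totalDegree_finsetSum_le fun i _ => (totalDegree_mul _ _).trans ?_
    rw [totalDegree_C, totalDegree_X_pow, zero_add]
  set F₀ : MvPolynomial (Fin k) ℂ := ∑ i : Fin k, C ((n : ℂ)⁻¹) * X i ^ n with hF₀def
  have hres : aeval (restr ℂ n k) f₀ = F₀ := by
    simp only [hf₀def, hF₀def, map_sum, map_mul, map_pow, aeval_X, restr_castLE, aeval_C,
      algebraMap_eq]
  have hhom : F₀.IsHomogeneous n := by
    refine IsHomogeneous.sum _ _ _ fun i _ => ?_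
    simpa using (isHomogeneous_C (Fin k) ((n : ℂ)⁻¹)).mul (isHomogeneous_X_pow (i : Fin k) n)
  have hn0 : (n : ℂ) ≠ 0 := Nat.cast_ne_zero.2 (by omega)
  have hpd : ∀ i : Fin k, pderiv i F₀ = X i ^ (n - 1) := by
    intro i
    rw [hF₀def, map_sum, Finset.sum_eq_single i]
    · rw [pderiv_C_mul, pderiv_pow, pderiv_X_self, mul_one, ← mul_assoc, ← map_natCast C n,
        ← map_mul, inv_mul_cancel₀ hn0, map_one, one_mul]
    · intro j _ hj
      rw [pderiv_C_mul, pderiv_pow, pderiv_X_of_ne hj, mul_zero, mul_zero]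
    · simp
  intro h0
  have h1 := eval_certPoly k f₀ hdeg
  rw [h0, map_zero, hres, homogeneousComponent_eq_self hhom] at h1
  simp_rw [hpd] at h1
  rw [det_macaulay_X_pow] at h1
  exact zero_ne_one h1

/-- **Memo S2 + capstone**: modulo the AG count, the certificate vanishes on every `f` of degree
`≤ n` and complexity `≤ s` as soon as `2^(k+3s) < (n-1)^k`. -/
theorem eval_certPoly_eq_zero {n k s : ℕ} (hAG : GenericGradientFibreCount k n)
    (hbig : 2 ^ (k + 3 * s) < (n - 1) ^ k) (f : MvPolynomial (Fin n) ℂ)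
    (hdeg : f.totalDegree ≤ n) (hs : complexity f ≤ s) :
    eval (coeffVector (degLEMonomials n) f) (certPoly n k) = 0 := by
  rw [eval_certPoly k f hdeg]
  exact det_macaulay_grad_topForm_eq_zero hAG f hs (restr ℂ n k) (restr_spec n k)
    ((totalDegree_aeval_restr_le f).trans hdeg) hbig

/-- **The item, modulo exactly three inputs** (all that is left for a prover): for a choice of
`k = k(n)`, (1) the AG count `GenericGradientFibreCount (k n) n`, (2) the arithmetic
`1 ≤ k n ≤ n ∧ 2^(k n + 3cn) < (n-1)^(k n)` (true for `k n = ⌊3cn/(log₂(n-1)-1)⌋ + 1`, `n ≥ n₀(c)`),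
(3) the size bound `certPoly n (k n) ∈ Distinguishers ℂ n a`. Conclusion = the body of
`BarrierLever.NaturalProofsAgainstAllLinearSizes` at level `c`. -/
theorem naturalProofsAgainstLinearSize_of_inputs (c a n₀ : ℕ) (k : ℕ → ℕ)
    (hAG : ∀ n, n₀ ≤ n → GenericGradientFibreCount (k n) n)
    (harith : ∀ n, n₀ ≤ n → 1 ≤ n ∧ k n ≤ n ∧ 2 ^ (k n + 3 * (c * n)) < (n - 1) ^ (k n))
    (hsize : ∀ n, n₀ ≤ n → certPoly n (k n) ∈ Distinguishers ℂ n a) :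
    ∀ n ≥ n₀, ¬ IsSuccinctHittingSet (degLEMonomials n)
      {f : MvPolynomial (Fin n) ℂ | f.totalDegree ≤ n ∧ complexity f ≤ c * n}
      (Distinguishers ℂ n a) := by
  intro n hn hHit
  obtain ⟨h1, hkn, hbig⟩ := harith n hn
  obtain ⟨f, hf, hne⟩ := hHit (certPoly n (k n)) (hsize n hn) (certPoly_ne_zero h1 hkn)
  exact hne (eval_certPoly_eq_zero (hAG n hn) hbig f hf.1 hf.2)

end Summit.ValiantsHypothesis.ValiantsHypothesis.Theorems.BarrierLever.NaturalProofsAgainstAllLinearSizes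

end
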